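import Literature.NumberTheory.Sieve.QuadraticRootsPrimeModuliDFIBilinearOffDiag
import Literature.NumberTheory.Sieve.QuadraticRootsPrimeModuliDFIBilinearBlocks
import HarnessLib

/-!
# Duke–Friedlander–Iwaniec 1995, §5: bookkeeping for "Summing over all `n₁, n₂`"

Topic `Literature/NumberTheory/Sieve`.  Eighth file of the deduction of DFI's Propositions 1–2
from Proposition 4 (W. Duke, J. B. Friedlander, H. Iwaniec, Ann. of Math. 141 (1995), §5
p. 433).  The elementary ingredients of the last lines of §5 — "Summing over all `n₁, n₂` we
infer that `B²(M, N) ≪ ‖αρ‖² ‖β‖² (M + N^{3/2} M^{3/4+ε})`, which concludes the proof of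
Proposition 2 in case `N² ≪ M`.  The last condition is unnecessary since the proposition is
otherwise trivial." — PROVED here:

* `DFI1995.norm_bilinearForm_le_trivial` — the "otherwise trivial" bound
  `|B(M, N)| ≤ B_ρ √(2M) √(2N) ‖αρ‖ ‖β‖` (Cauchy's inequality, `|ρ_h(mn)| ≤ ρ(m)ρ(n)`, `ρ(n) ≤ B_ρ`
  on the support of `β`);
* `DFI1995.one_le_sum_plateau` / `DFI1995.pieceWeight_*` — four plateau weights at the scales
  `M'_k = (3/4) M (5/4)^k`, `k < 4`, each admissible for (25) at its own scale (support
  `[M'_k, 2M'_k]`, `|g^{(j)}| ≤ M'_k^{−j}`) and together `≥ 1/(162B)` on `(M, 2M]`: the paper's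
  single majorant "supported on `[M/2, 4M]`" is replaced by four dyadically supported ones so that
  (25) applies verbatim;
* `DFI1995.pieceScale_bounds`, `DFI1995.coverWeight`, `DFI1995.norm_sum_coverWeight_le` — the scales
  `1 ≤ M'_k ≤ (3/2)M`, `2M'_k ≤ 3M` for `M ≥ 2`, the cover weight `G = ∑_{k<4} pieceWeight_k` and the
  splitting of `G`-weighted sums along the pieces;
* `DFI1995.sq_sum_le_card_mul_sum_sq`, `DFI1995.sq_sum_mul_le`, `DFI1995.sum_sqrt_gcd_primes_le` —
  Cauchy's inequality in `n` and the count `∑_{N < p ≤ 2N} (h, p)^{1/2} ≤ 2N + 2√(2N) log h`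
  (a prime `p ∤ h` has `(h, p) = 1`; at most `ω(h) ≤ 2 log h` primes divide `h`), which controls
  the factor `(h(n₂ − n₁), n₁n₂)^{1/4} = (h, n₁)^{1/4} (h, n₂)^{1/4}` coming from (25)
  uniformly in `h ≤ C₂MN` (a point the paper's `≪` leaves implicit).

## References

* W. Duke, J. B. Friedlander, H. Iwaniec, Ann. of Math. (2) 141 (1995), 423–441, §5 p. 433.
  [cite: DukeFriedlanderIwaniec1995, §5 p. 433]
-/

noncomputable section

namespace Literature.NumberTheory.Sieve

open scoped BigOperators Polynomial ComplexConjugate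
open Finset Polynomial

namespace DFI1995

/-! ### Cauchy's inequality in one variable -/

/-- `(∑_{i ∈ s} u_i)² ≤ #s · ∑ u_i²`. [folklore] -/
theorem sq_sum_le_card_mul_sum_sq (s : Finset ℕ) (u : ℕ → ℝ) :
    (∑ i ∈ s, u i) ^ 2 ≤ s.card * ∑ i ∈ s, u i ^ 2 := by
  have := Finset.sum_mul_sq_le_sq_mul_sq s u (fun _ => (1 : ℝ))
  simp only [mul_one, one_pow, Finset.sum_const, nsmul_eq_mul] at this
  linarith

/-- `(∑_{i ∈ s} u_i w_i)² ≤ (∑_{i ∈ s, u_i ≠ 0} w_i²) · ∑ u_i²`. [folklore] -/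
theorem sq_sum_mul_le (s : Finset ℕ) (u w : ℕ → ℝ) :
    (∑ i ∈ s, u i * w i) ^ 2 ≤ (∑ i ∈ s.filter (fun i => u i ≠ 0), w i ^ 2) * ∑ i ∈ s, u i ^ 2 := by
  classical
  have heq : ∑ i ∈ s, u i * w i = ∑ i ∈ s, u i * (if u i ≠ 0 then w i else 0) := by
    refine Finset.sum_congr rfl fun i _ => ?_
    split_ifs with h
    · rfl
    · rw [not_not.1 h, zero_mul, zero_mul]
  rw [heq]
  have := Finset.sum_mul_sq_le_sq_mul_sq s u (fun i => if u i ≠ 0 then w i else 0)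
  refine this.trans ?_
  rw [mul_comm]
  refine mul_le_mul_of_nonneg_right (le_of_eq ?_) (Finset.sum_nonneg fun _ _ => sq_nonneg _)
  rw [Finset.sum_filter]
  refine Finset.sum_congr rfl fun i _ => ?_
  split_ifs <;> simp

/-- `∑_{i ∈ s} u_i ≤ √#s · √(∑ u_i²)` for `u ≥ 0`. [folklore] -/
theorem sum_le_sqrt_card_mul_sqrt (s : Finset ℕ) {u : ℕ → ℝ} (hu : ∀ i, 0 ≤ u i) :
    ∑ i ∈ s, u i ≤ Real.sqrt s.card * Real.sqrt (∑ i ∈ s, u i ^ 2) := by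
  rw [← Real.sqrt_mul (Nat.cast_nonneg _), ← Real.sqrt_sq (Finset.sum_nonneg fun i _ => hu i)]
  exact Real.sqrt_le_sqrt (sq_sum_le_card_mul_sum_sq s u)

/-! ### The trivial bound -/

/-- **"The proposition is otherwise trivial"** (p. 433): if `ρ_f(n) ≤ B_ρ` whenever `β_n ≠ 0`, then
`|B(M, N)| ≤ B_ρ √(2M) √(2N) ‖αρ‖ ‖β‖` (`|ρ_h(mn)| ≤ ρ(mn) = ρ(m) ρ(n)` for `(m, n) = 1` and
Cauchy's inequality in `m` and in `n`). [cite: DukeFriedlanderIwaniec1995, §5 p. 433] -/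
theorem norm_bilinearForm_le_trivial (f : ℤ[X]) (h : ℤ) (α β : ℕ → ℂ) {M N Bρ : ℝ} (hM : 0 ≤ M)
    (hN : 0 ≤ N) (hBρ : 0 ≤ Bρ) (hρ : ∀ n : ℕ, β n ≠ 0 → (polyRootCountMod ![f] n : ℝ) ≤ Bρ) :
    ‖bilinearForm f h α β M N‖ ≤
      Bρ * Real.sqrt (2 * M) * Real.sqrt (2 * N) * normAlphaRho f α M * l2Norm β N := by
  unfold bilinearForm
  set Sm := Icc 1 ⌊2 * M⌋₊ with hSm
  set Sn := Icc 1 ⌊2 * N⌋₊ with hSn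
  -- termwise
  have h1 : ‖∑ m ∈ Sm, ∑ n ∈ Sn.filter (fun n => Nat.Coprime m n), α m * β n * polyRootWeylSum f (m * n) h‖ ≤
      ∑ m ∈ Sm, ‖α m‖ * (polyRootCountMod ![f] m : ℝ) * ∑ n ∈ Sn, ‖β n‖ * Bρ := by
    refine (norm_sum_le _ _).trans (Finset.sum_le_sum fun m _ => ?_)
    refine (norm_sum_le _ _).trans ?_
    rw [Finset.mul_sum]
    calc ∑ n ∈ Sn.filter (fun n => Nat.Coprime m n), ‖α m * β n * polyRootWeylSum f (m * n) h‖
        ≤ ∑ n ∈ Sn.filter (fun n => Nat.Coprime m n), ‖α m‖ * (polyRootCountMod ![f] m : ℝ) * (‖β n‖ * Bρ) := by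
          refine Finset.sum_le_sum fun n hn => ?_
          rw [Finset.mem_filter] at hn
          rw [norm_mul, norm_mul]
          by_cases hβ : β n = 0
          · rw [hβ, norm_zero]; simp
          have hρmn : ‖polyRootWeylSum f (m * n) h‖ ≤ (polyRootCountMod ![f] m : ℝ) * (polyRootCountMod ![f] n : ℝ) := by
            have := norm_polyRootWeylSum_le f (m * n) h
            rw [polyRootCountMod_mul_of_coprime f hn.2] at this
            exact_mod_cast this
          calc ‖α m‖ * ‖β n‖ * ‖polyRootWeylSum f (m * n) h‖
              ≤ ‖α m‖ * ‖β n‖ * ((polyRootCountMod ![f] m : ℝ) * Bρ) := by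
                refine mul_le_mul_of_nonneg_left (hρmn.trans ?_) (by positivity)
                exact mul_le_mul_of_nonneg_left (hρ n hβ) (Nat.cast_nonneg _)
            _ = ‖α m‖ * (polyRootCountMod ![f] m : ℝ) * (‖β n‖ * Bρ) := by ring
      _ ≤ ∑ n ∈ Sn, ‖α m‖ * (polyRootCountMod ![f] m : ℝ) * (‖β n‖ * Bρ) :=
          Finset.sum_le_sum_of_subset_of_nonneg (Finset.filter_subset _ _) fun _ _ _ => by positivity
  refine h1.trans ?_
  rw [← Finset.sum_mul, ← Finset.sum_mul]
  -- Cauchy in `m` and in `n`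
  have hA : ∑ m ∈ Sm, ‖α m‖ * (polyRootCountMod ![f] m : ℝ) ≤ Real.sqrt (2 * M) * normAlphaRho f α M := by
    have := sum_le_sqrt_card_mul_sqrt Sm (u := fun m => ‖α m‖ * (polyRootCountMod ![f] m : ℝ))
      (fun m => by positivity)
    refine this.trans ?_
    have hcard : Real.sqrt (Sm.card : ℝ) ≤ Real.sqrt (2 * M) := by
      refine Real.sqrt_le_sqrt ?_
      rw [hSm, Nat.card_Icc]
      simp only [add_tsub_cancel_right]
      exact Nat.floor_le (by positivity)
    have heq : Real.sqrt (∑ m ∈ Sm, (‖α m‖ * (polyRootCountMod ![f] m : ℝ)) ^ 2) = normAlphaRho f α M := by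
      rw [normAlphaRho]
      congr 1
      refine Finset.sum_congr rfl fun m _ => ?_
      ring
    rw [heq]
    exact mul_le_mul_of_nonneg_right hcard (Real.sqrt_nonneg _)
  have hB : ∑ n ∈ Sn, ‖β n‖ ≤ Real.sqrt (2 * N) * l2Norm β N := by
    have := sum_le_sqrt_card_mul_sqrt Sn (u := fun n => ‖β n‖) (fun n => norm_nonneg _)
    refine this.trans ?_
    have hcard : Real.sqrt (Sn.card : ℝ) ≤ Real.sqrt (2 * N) := by
      refine Real.sqrt_le_sqrt ?_
      rw [hSn, Nat.card_Icc]
      simp only [add_tsub_cancel_right]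
      exact Nat.floor_le (by positivity)
    rw [l2Norm]
    exact mul_le_mul_of_nonneg_right hcard (Real.sqrt_nonneg _)
  have hA0 : 0 ≤ ∑ m ∈ Sm, ‖α m‖ * (polyRootCountMod ![f] m : ℝ) := Finset.sum_nonneg fun _ _ => by positivity
  have hB0 : 0 ≤ ∑ n ∈ Sn, ‖β n‖ := Finset.sum_nonneg fun _ _ => norm_nonneg _
  have hnA : 0 ≤ normAlphaRho f α M := Real.sqrt_nonneg _
  calc (∑ m ∈ Sm, ‖α m‖ * (polyRootCountMod ![f] m : ℝ)) * ((∑ n ∈ Sn, ‖β n‖) * Bρ)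
      ≤ (Real.sqrt (2 * M) * normAlphaRho f α M) * ((Real.sqrt (2 * N) * l2Norm β N) * Bρ) :=
        mul_le_mul hA (mul_le_mul_of_nonneg_right hB hBρ) (by positivity)
          (mul_nonneg (Real.sqrt_nonneg _) hnA)
    _ = Bρ * Real.sqrt (2 * M) * Real.sqrt (2 * N) * normAlphaRho f α M * l2Norm β N := by ring

/-! ### Four plateau weights covering `(M, 2M]` -/

/-- The dyadic points `P_k = M (5/4)^k`. [folklore] -/
def piecePt (M : ℝ) (k : ℕ) : ℝ := M * (5 / 4 : ℝ) ^ k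

/-- The `k`-th piece weight: the plateau equal to `1` on `[P_k, (5/4)P_k]` and supported in
`((3/4)P_k, (3/2)P_k) = (M'_k, 2M'_k)`, `M'_k = (3/4)P_k`. [folklore] -/
def pieceWeight (M : ℝ) (k : ℕ) : ℝ → ℝ :=
  plateau (3 / 4 * piecePt M k) (3 / 2 * piecePt M k) (1 / 4 * piecePt M k)

/-- `P_k > 0`. [folklore] -/
theorem piecePt_pos {M : ℝ} (hM : 0 < M) (k : ℕ) : 0 < piecePt M k := by
  unfold piecePt; positivity

/-- **The pieces cover `(M, 2M]`**: for `M < t ≤ 2M`, `∑_{k < 4} pieceWeight M k t ≥ 1`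
(`[M, (5/4)⁴M] ⊇ (M, 2M]`, `(5/4)⁴ = 625/256 > 2`). [folklore] -/
theorem one_le_sum_pieceWeight {M t : ℝ} (hM : 0 < M) (h1 : M < t) (h2 : t ≤ 2 * M) :
    1 ≤ ∑ k ∈ Finset.range 4, pieceWeight M k t := by
  have hnonneg : ∀ k ∈ Finset.range 4, 0 ≤ pieceWeight M k t := fun k _ =>
    plateau_nonneg (by have := piecePt_pos hM k; positivity)
      (by have := piecePt_pos hM k; linarith) t
  -- locate `t` in one of the pieces `[P_k, (5/4) P_k]`
  have key : ∃ k ∈ Finset.range 4, piecePt M k ≤ t ∧ t ≤ 5 / 4 * piecePt M k := by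
    simp only [piecePt, Finset.mem_range]
    rcases le_or_gt t (5 / 4 * M) with h0 | h0
    · exact ⟨0, by norm_num, by norm_num; linarith, by norm_num; linarith⟩
    rcases le_or_gt t ((5 / 4) ^ 2 * M) with h1' | h1'
    · exact ⟨1, by norm_num, by norm_num; linarith, by norm_num at h1' ⊢; linarith⟩
    rcases le_or_gt t ((5 / 4) ^ 3 * M) with h2' | h2'
    · refine ⟨2, by norm_num, ?_, ?_⟩ <;> norm_num at h1' h2' ⊢ <;> linarith
    · refine ⟨3, by norm_num, ?_, ?_⟩ <;> norm_num at h2' ⊢ <;> nlinarith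
  obtain ⟨k, hk, hk1, hk2⟩ := key
  have hval : pieceWeight M k t = 1 := by
    unfold pieceWeight
    have hP := piecePt_pos hM k
    exact plateau_of_mem (by positivity) (by linarith) (by linarith)
  calc (1 : ℝ) = pieceWeight M k t := hval.symm
    _ ≤ ∑ k ∈ Finset.range 4, pieceWeight M k t := Finset.single_le_sum hnonneg hk

/-- `0 ≤ pieceWeight ≤ 1`. [folklore] -/
theorem pieceWeight_mem {M : ℝ} (hM : 0 < M) (k : ℕ) (t : ℝ) :
    0 ≤ pieceWeight M k t ∧ pieceWeight M k t ≤ 1 := by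
  have hP := piecePt_pos hM k
  exact ⟨plateau_nonneg (by positivity) (by linarith) t, plateau_le_one _ _ _ _⟩

/-- Support of the piece weights: inside `[M'_k, 2M'_k]`, `M'_k = (3/4) P_k`. [folklore] -/
theorem pieceWeight_ne_zero {M : ℝ} (hM : 0 < M) (k : ℕ) {t : ℝ} (ht : pieceWeight M k t ≠ 0) :
    3 / 4 * piecePt M k ≤ t ∧ t ≤ 2 * (3 / 4 * piecePt M k) := by
  have hP := piecePt_pos hM k
  obtain ⟨h1, h2⟩ := plateau_ne_zero (by positivity) (by linarith) ht
  constructor <;> linarith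

/-- The piece weights are smooth. [folklore] -/
theorem contDiff_pieceWeight (M : ℝ) (k : ℕ) {n : ℕ∞} : ContDiff ℝ n (pieceWeight M k) :=
  contDiff_plateau _ _ _

/-- **Derivative bounds at scale `M'_k`**: `|(pieceWeight/(162B))^{(j)}| ≤ M'_k^{−j}` for `j ≤ 4`
(`|plateau^{(j)}| ≤ 2B L^{−j}` with `L = P_k/4 = M'_k/3`, `3^j ≤ 81`). [folklore] -/
theorem abs_iteratedDeriv_pieceWeight_div_le {B : ℝ} (hB1 : 1 ≤ B)
    (hB : ∀ n : ℕ, n ≤ 4 → ∀ x : ℝ, |iteratedDeriv n Real.smoothTransition x| ≤ B) {M : ℝ} (hM : 0 < M)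
    (k : ℕ) {j : ℕ} (hj : j ≤ 4) (t : ℝ) :
    |iteratedDeriv j (fun s => pieceWeight M k s / (162 * B)) t| ≤ (3 / 4 * piecePt M k) ^ (-(j : ℝ)) := by
  have hP := piecePt_pos hM k
  have hBpos : 0 < 162 * B := by linarith
  rw [iteratedDeriv_div_const, abs_div, abs_of_pos hBpos]
  have h1 := abs_iteratedDeriv_plateau_le hB (3 / 4 * piecePt M k) (3 / 2 * piecePt M k)
    (L := 1 / 4 * piecePt M k) (by positivity) hj t
  change |iteratedDeriv j (pieceWeight M k) t| ≤ _ at h1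
  rw [div_le_iff₀ hBpos]
  refine h1.trans ?_
  rw [Real.rpow_neg (by positivity), Real.rpow_natCast, ← inv_pow]
  rw [show (1 / 4 * piecePt M k)⁻¹ = 3 * (3 / 4 * piecePt M k)⁻¹ by rw [mul_inv, mul_inv]; ring, mul_pow]
  have h3 : (3 : ℝ) ^ j ≤ 81 := by
    calc (3 : ℝ) ^ j ≤ 3 ^ 4 := pow_le_pow_right₀ (by norm_num) hj
      _ = 81 := by norm_num
  have hx : 0 ≤ ((3 / 4 * piecePt M k)⁻¹) ^ j := by positivity
  calc 2 * B * (3 ^ j * ((3 / 4 * piecePt M k)⁻¹) ^ j) = (2 * B * 3 ^ j) * ((3 / 4 * piecePt M k)⁻¹) ^ j := by ring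
    _ ≤ (2 * B * 81) * ((3 / 4 * piecePt M k)⁻¹) ^ j := by gcongr
    _ = ((3 / 4 * piecePt M k)⁻¹) ^ j * (162 * B) := by ring

/-! ### The `gcd` count over primes -/

/-- **`∑_{N < p ≤ 2N, p prime} (h, p)^{1/2} ≤ 2N + 2√(2N) log h`** (`h, N ≥ 1`): a prime `p ∤ h` has
`(h, p) = 1`, and the primes dividing `h` are at most `ω(h) ≤ 2 log h` in number, each
contributing `p^{1/2} ≤ (2N)^{1/2}`. [folklore] -/
theorem sum_sqrt_gcd_primes_le {h : ℕ} (hh : 1 ≤ h) {N : ℝ} (hN : 0 ≤ N) :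
    ∑ n ∈ (Icc 1 ⌊2 * N⌋₊).filter Nat.Prime, Real.sqrt (Nat.gcd h n : ℝ) ≤
      2 * N + 2 * Real.sqrt (2 * N) * Real.log h := by
  classical
  set S := (Icc 1 ⌊2 * N⌋₊).filter Nat.Prime with hS
  rw [← Finset.sum_filter_add_sum_filter_not S (fun n => n ∣ h)]
  have h1 : ∑ n ∈ S.filter (fun n => ¬ n ∣ h), Real.sqrt (Nat.gcd h n : ℝ) ≤ 2 * N := by
    calc ∑ n ∈ S.filter (fun n => ¬ n ∣ h), Real.sqrt (Nat.gcd h n : ℝ)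
        = ∑ n ∈ S.filter (fun n => ¬ n ∣ h), (1 : ℝ) := by
          refine Finset.sum_congr rfl fun n hn => ?_
          rw [Finset.mem_filter, hS, Finset.mem_filter] at hn
          have hcop : Nat.Coprime h n := (Nat.coprime_comm.1 ((Nat.Prime.coprime_iff_not_dvd hn.1.2).2 hn.2))
          rw [Nat.Coprime] at hcop
          rw [hcop]; simp
      _ = ((S.filter (fun n => ¬ n ∣ h)).card : ℝ) := by rw [Finset.sum_const, nsmul_eq_mul, mul_one]
      _ ≤ ((Icc 1 ⌊2 * N⌋₊).card : ℝ) := by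
          exact_mod_cast Finset.card_le_card ((Finset.filter_subset _ _).trans (Finset.filter_subset _ _))
      _ ≤ 2 * N := by
          rw [Nat.card_Icc]; simp only [add_tsub_cancel_right]; exact Nat.floor_le (by positivity)
  have h2 : ∑ n ∈ S.filter (fun n => n ∣ h), Real.sqrt (Nat.gcd h n : ℝ) ≤ 2 * Real.sqrt (2 * N) * Real.log h := by
    have hterm : ∀ n ∈ S.filter (fun n => n ∣ h), Real.sqrt (Nat.gcd h n : ℝ) ≤ Real.sqrt (2 * N) := by
      intro n hn
      rw [Finset.mem_filter, hS, Finset.mem_filter, Finset.mem_Icc] at hn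
      refine Real.sqrt_le_sqrt ?_
      calc (Nat.gcd h n : ℝ) ≤ n := by exact_mod_cast Nat.gcd_le_right _ hn.1.1.1
        _ ≤ 2 * N := by
            have := (Nat.le_floor_iff (by positivity)).1 hn.1.1.2
            exact_mod_cast this
    refine (Finset.sum_le_sum hterm).trans ?_
    rw [Finset.sum_const, nsmul_eq_mul]
    have hcard : ((S.filter (fun n => n ∣ h)).card : ℝ) ≤ 2 * Real.log h := by
      have hsub : S.filter (fun n => n ∣ h) ⊆ h.primeFactors := by
        intro n hn
        rw [Finset.mem_filter, hS, Finset.mem_filter] at hn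
        exact Nat.mem_primeFactors.2 ⟨hn.1.2, hn.2, by omega⟩
      calc ((S.filter (fun n => n ∣ h)).card : ℝ) ≤ (h.primeFactors.card : ℝ) := by
            exact_mod_cast Finset.card_le_card hsub
        _ = (ArithmeticFunction.cardDistinctFactors h : ℝ) := by
            rw [cardDistinctFactors_eq_card_primeFactors]
        _ ≤ 2 * Real.log h := cardDistinctFactors_le_two_mul_log hh
    calc ((S.filter (fun n => n ∣ h)).card : ℝ) * Real.sqrt (2 * N) ≤ (2 * Real.log h) * Real.sqrt (2 * N) :=
          mul_le_mul_of_nonneg_right hcard (Real.sqrt_nonneg _)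
      _ = 2 * Real.sqrt (2 * N) * Real.log h := by ring
  linarith

/-! ### The scales `M'_k = (3/4) M (5/4)^k` -/

/-- For `M ≥ 2` and `k < 4`: `1 ≤ M'_k`, `2M'_k ≤ 3M`, `(3/4)M ≤ M'_k ≤ (3/2)M`. [folklore] -/
theorem pieceScale_bounds {M : ℝ} (hM : 2 ≤ M) {k : ℕ} (hk : k < 4) :
    1 ≤ 3 / 4 * piecePt M k ∧ 2 * (3 / 4 * piecePt M k) ≤ 3 * M ∧
      3 / 4 * M ≤ 3 / 4 * piecePt M k ∧ 3 / 4 * piecePt M k ≤ 3 / 2 * M := by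
  unfold piecePt
  have hpow1 : (1 : ℝ) ≤ (5 / 4 : ℝ) ^ k := one_le_pow₀ (by norm_num)
  have hpow2 : (5 / 4 : ℝ) ^ k ≤ 125 / 64 := by
    calc (5 / 4 : ℝ) ^ k ≤ (5 / 4) ^ 3 := pow_le_pow_right₀ (by norm_num) (by omega)
      _ = 125 / 64 := by norm_num
  have hM0 : 0 < M := by linarith
  refine ⟨by nlinarith, by nlinarith, by nlinarith, by nlinarith⟩

/-- The cover weight `G(m) = ∑_{k<4} pieceWeight M k (m)`. [folklore] -/
def coverWeight (M : ℝ) (m : ℕ) : ℝ := ∑ k ∈ Finset.range 4, pieceWeight M k m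

/-- Splitting the weighted inner sums along the four pieces. [folklore] -/
theorem norm_sum_coverWeight_le (M : ℝ) (S : Finset ℕ) (Y : ℕ → ℂ) :
    ‖∑ m ∈ S, (coverWeight M m : ℂ) * Y m‖ ≤
      ∑ k ∈ Finset.range 4, ‖∑ m ∈ S, (pieceWeight M k m : ℂ) * Y m‖ := by
  have : ∑ m ∈ S, (coverWeight M m : ℂ) * Y m =
      ∑ k ∈ Finset.range 4, ∑ m ∈ S, (pieceWeight M k m : ℂ) * Y m := by
    rw [Finset.sum_comm]
    refine Finset.sum_congr rfl fun m _ => ?_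
    rw [coverWeight, Complex.ofReal_sum, Finset.sum_mul]
  rw [this]
  exact norm_sum_le _ _

end DFI1995

end Literature.NumberTheory.Sieve
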